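import Mathlib

/-!
# Crux `PeriodicWindows` (stmt-AtomisticToContinuum-3240), line `dense-laminar-hull` — stub `hc_blockSum`
# The abstract block summation of the hollow closing

The combinatorial core of the competitor comparison of the hollow closing (`stub_hollowClosing`), as a
statement about real sequences. `D m m'` are the pair differences of the layer interactions (summable in `m'`
for each layer `m`, zero on the diagonal), `d i ≥ 0` the offset defects (`≤ dmax`), `b i ≥ 0` the gap gains,
`h k ≥ 0` the far-layer quadratic constants. Adjacent pairs gain `κ d_m² + b_m` in both orientations, a far
pair `(m, m ± k)` (`k ≥ 2`) loses at most `h_k · k · ∑_{i ∈ window} d_i²` over the window of the `k` interfaces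
between the two layers, and `∑_k 2k² h_k ≤ κ`, `∑_k k³ h_k ≤ cB` (all finite truncations). Then over any block
`I = [m₁, m₁ + n)` of layers

`∑_{m ∈ I} ∑'_{m'} D m m' ≥ ∑_{m ∈ I} (κ d_m² + b_m) − (2 cB + 2 κ) dmax²` (`hc_blockSum`).

Proof. For a layer `m` the symmetric partial sums `S_K(m) = ∑_{k < K} (D m (m+k) + D m (m−k))` converge to
`∑'_{m'} D m m'` (`HasSum.nat_add_neg` for the shifted family, `D m m = 0`; `hcbk_tendsto`), so it suffices to
bound `∑_{m ∈ I} S_{K'+2}(m)` from below for every `K'` (`hcbk_finite`) and pass to the limit (`ge_of_tendsto`).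
Per layer (`hcbk_per_layer`), `S_{K'+2}(m) ≥ κ d_m² + b_m + κ d_{m−1}² − ∑_{k=2}^{K'+1} h_k k (w(m,k) + w(m−k,k))`
with the windows `w(a,k) = ∑_{t<k} d_{a+t}²`. Summing over `m = m₁ + j`, `j < n`, and exchanging the order of
summation, every loss term is a sum over `t < k` of *shifted blocks* `W(c) = ∑_{j<n} d_{c+j}²` with
`|c − (m₁ − 1)| ≤ k`, and a shifted block exceeds `W(m₁ − 1)` by at most `k · dmax²` (`hcbk_window_le`: moving a
block by one step changes it by at most `dmax²`). Hence the total loss is at most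
`∑_k h_k k · 2k (W(m₁−1) + k dmax²) ≤ κ W(m₁−1) + 2 cB dmax²` (`hcbk_loss_sum`), while the extra adjacent gains
`κ ∑_{m ∈ I} d_{m−1}²` are exactly `κ W(m₁ − 1)`. Pure finite double sums plus one limit. [folklore]
-/

noncomputable section

namespace Summit.AtomisticToContinuum.Crystallization.Theorems.PeriodicWindowsDenseLaminarHull

open Filter Metric
open scoped BigOperators Topology

/-- Squares of the defects are at most `dmax ^ 2`. [folklore] -/
theorem hcbk_sq_le {d : ℤ → ℝ} {dmax : ℝ} (hd : ∀ i, 0 ≤ d i ∧ d i ≤ dmax) (i : ℤ) :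
    d i ^ 2 ≤ dmax ^ 2 :=
  pow_le_pow_left₀ (hd i).1 (hd i).2 2

/-- An integer-interval sum `∑_{i ∈ [a, a + k)}` as a `range` sum. [folklore] -/
theorem hcbk_sum_Ico_eq_sum_range (F : ℤ → ℝ) (a : ℤ) (k : ℕ) :
    ∑ i ∈ Finset.Ico a (a + k), F i = ∑ t ∈ Finset.range k, F (a + t) := by
  induction k with
  | zero => simp
  | succ k ih =>
    have hsplit : Finset.Ico a (a + ((k + 1 : ℕ) : ℤ)) = Finset.Ico a (a + k) ∪ {a + (k : ℤ)} := by
      ext x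
      simp only [Finset.mem_Ico, Finset.mem_union, Finset.mem_singleton]
      push_cast
      omega
    have hdisj : Disjoint (Finset.Ico a (a + k)) {a + (k : ℤ)} := by
      rw [Finset.disjoint_singleton_right, Finset.mem_Ico]
      omega
    rw [hsplit, Finset.sum_union hdisj, Finset.sum_singleton, ih, Finset.sum_range_succ]

/-- Peeling the two innermost shells off a symmetric partial sum over `range (K' + 2)`. [folklore] -/
theorem hcbk_range_add_two (g : ℕ → ℝ) (K' : ℕ) :
    ∑ k ∈ Finset.range (K' + 2), g k = ∑ k ∈ Finset.range K', g (k + 2) + g 1 + g 0 := by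
  rw [Finset.sum_range_succ', Finset.sum_range_succ']

/-- A truncated coefficient sum over `Icc 2 (K' + 1)` as a `range K'` sum. [folklore] -/
theorem hcbk_Icc_range (F : ℕ → ℝ) (K' : ℕ) :
    ∑ k ∈ Finset.Icc 2 (K' + 1), F k = ∑ k ∈ Finset.range K', F (k + 2) := by
  symm
  refine Finset.sum_nbij' (fun k => k + 2) (fun k => k - 2) ?_ ?_ ?_ ?_ ?_
  · intro a ha
    rw [Finset.mem_range] at ha
    rw [Finset.mem_Icc]
    omega
  · intro a ha
    rw [Finset.mem_Icc] at ha
    rw [Finset.mem_range]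
    omega
  · intro a _
    omega
  · intro a ha
    rw [Finset.mem_Icc] at ha
    omega
  · intro a _
    rfl

/-- Shifting a block of `n` consecutive squared defects by one step. [folklore] -/
theorem hcbk_window_succ (d : ℤ → ℝ) (c : ℤ) (n : ℕ) :
    ∑ j ∈ Finset.range n, d (c + 1 + j) ^ 2 + d c ^ 2 =
      ∑ j ∈ Finset.range n, d (c + j) ^ 2 + d (c + n) ^ 2 := by
  have h1 := Finset.sum_range_succ' (fun j : ℕ => d (c + j) ^ 2) n
  have h2 := Finset.sum_range_succ (fun j : ℕ => d (c + j) ^ 2) n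
  have h3 : ∀ j : ℕ, (c + ((j + 1 : ℕ) : ℤ)) = c + 1 + j := fun j => by push_cast; ring
  simp only [h3, Nat.cast_zero, add_zero] at h1
  linarith

/-- One-step comparison of shifted blocks: moving a block by one changes it by at most `dmax ^ 2`.
[folklore] -/
theorem hcbk_window_step {d : ℤ → ℝ} {dmax : ℝ} (hd : ∀ i, 0 ≤ d i ∧ d i ≤ dmax) (c : ℤ) (n : ℕ) :
    ∑ j ∈ Finset.range n, d (c + 1 + j) ^ 2 ≤ ∑ j ∈ Finset.range n, d (c + j) ^ 2 + dmax ^ 2 ∧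
      ∑ j ∈ Finset.range n, d (c + j) ^ 2 ≤ ∑ j ∈ Finset.range n, d (c + 1 + j) ^ 2 + dmax ^ 2 := by
  have h1 := hcbk_window_succ d c n
  have h2 := hcbk_sq_le hd c
  have h3 := hcbk_sq_le hd (c + n)
  have h4 := sq_nonneg (d c)
  have h5 := sq_nonneg (d (c + n))
  constructor <;> linarith

/-- Blocks shifted to the right by `t` exceed the original block by at most `t * dmax ^ 2`. [folklore] -/
theorem hcbk_window_add_le {d : ℤ → ℝ} {dmax : ℝ} (hd : ∀ i, 0 ≤ d i ∧ d i ≤ dmax) (c : ℤ) (n t : ℕ) :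
    ∑ j ∈ Finset.range n, d (c + t + j) ^ 2 ≤ ∑ j ∈ Finset.range n, d (c + j) ^ 2 + t * dmax ^ 2 := by
  induction t with
  | zero => simp
  | succ t ih =>
    have h1 := (hcbk_window_step hd (c + t) n).1
    rw [show c + ((t + 1 : ℕ) : ℤ) = c + t + 1 by push_cast; ring]
    push_cast
    linarith

/-- Blocks shifted to the left by `t` exceed the original block by at most `t * dmax ^ 2`. [folklore] -/
theorem hcbk_window_sub_le {d : ℤ → ℝ} {dmax : ℝ} (hd : ∀ i, 0 ≤ d i ∧ d i ≤ dmax) (c : ℤ) (n t : ℕ) :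
    ∑ j ∈ Finset.range n, d (c - t + j) ^ 2 ≤ ∑ j ∈ Finset.range n, d (c + j) ^ 2 + t * dmax ^ 2 := by
  induction t with
  | zero => simp
  | succ t ih =>
    have h1 := (hcbk_window_step hd (c - t - 1) n).2
    rw [sub_add_cancel] at h1
    rw [show c - ((t + 1 : ℕ) : ℤ) = c - t - 1 by push_cast; ring]
    push_cast
    linarith

/-- A block shifted by at most `k` in either direction exceeds the original block by at most `k * dmax ^ 2`.
[folklore] -/
theorem hcbk_window_le {d : ℤ → ℝ} {dmax : ℝ} (hd : ∀ i, 0 ≤ d i ∧ d i ≤ dmax) (c c' : ℤ) (n k : ℕ)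
    (h1 : c' - c ≤ k) (h2 : c - c' ≤ k) :
    ∑ j ∈ Finset.range n, d (c' + j) ^ 2 ≤ ∑ j ∈ Finset.range n, d (c + j) ^ 2 + k * dmax ^ 2 := by
  have hdm : 0 ≤ dmax ^ 2 := sq_nonneg _
  rcases le_total c c' with hle | hle
  · obtain ⟨t, ht⟩ := Int.eq_ofNat_of_zero_le (sub_nonneg.mpr hle)
    have hc' : c' = c + t := by omega
    have htk : (t : ℝ) ≤ k := by exact_mod_cast (show (t : ℤ) ≤ k by omega)
    subst hc'
    have h3 := hcbk_window_add_le hd c n t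
    have h4 := mul_le_mul_of_nonneg_right htk hdm
    linarith
  · obtain ⟨t, ht⟩ := Int.eq_ofNat_of_zero_le (sub_nonneg.mpr hle)
    have hc' : c' = c - t := by omega
    have htk : (t : ℝ) ≤ k := by exact_mod_cast (show (t : ℤ) ≤ k by omega)
    subst hc'
    have h3 := hcbk_window_sub_le hd c n t
    have h4 := mul_le_mul_of_nonneg_right htk hdm
    linarith

/-- The forward losses of a block, double counted: `∑_{j<n} ∑_{t<k} d_{m₁+j+t}² ≤ k (W(m₁-1) + k dmax²)`.
[folklore] -/
theorem hcbk_fwd_sum {d : ℤ → ℝ} {dmax : ℝ} (hd : ∀ i, 0 ≤ d i ∧ d i ≤ dmax) (m₁ : ℤ) (n k : ℕ) :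
    ∑ j ∈ Finset.range n, ∑ t ∈ Finset.range k, d (m₁ + j + t) ^ 2 ≤
      k * (∑ j ∈ Finset.range n, d (m₁ - 1 + j) ^ 2 + k * dmax ^ 2) := by
  rw [Finset.sum_comm]
  have hb : ∀ t ∈ Finset.range k, ∑ j ∈ Finset.range n, d (m₁ + j + t) ^ 2 ≤
      ∑ j ∈ Finset.range n, d (m₁ - 1 + j) ^ 2 + k * dmax ^ 2 := by
    intro t ht
    rw [Finset.mem_range] at ht
    have e : ∀ j : ℕ, m₁ + (j : ℤ) + t = m₁ + t + j := fun j => by ring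
    simp only [e]
    exact hcbk_window_le hd (m₁ - 1) (m₁ + t) n k (by omega) (by omega)
  refine (Finset.sum_le_sum hb).trans ?_
  rw [Finset.sum_const, Finset.card_range, nsmul_eq_mul]

/-- The backward losses of a block, double counted: `∑_{j<n} ∑_{t<k} d_{m₁+j-k+t}² ≤ k (W(m₁-1) + k dmax²)`.
[folklore] -/
theorem hcbk_bwd_sum {d : ℤ → ℝ} {dmax : ℝ} (hd : ∀ i, 0 ≤ d i ∧ d i ≤ dmax) (m₁ : ℤ) (n k : ℕ) :
    ∑ j ∈ Finset.range n, ∑ t ∈ Finset.range k, d (m₁ + j - k + t) ^ 2 ≤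
      k * (∑ j ∈ Finset.range n, d (m₁ - 1 + j) ^ 2 + k * dmax ^ 2) := by
  rw [Finset.sum_comm]
  have hb : ∀ t ∈ Finset.range k, ∑ j ∈ Finset.range n, d (m₁ + j - k + t) ^ 2 ≤
      ∑ j ∈ Finset.range n, d (m₁ - 1 + j) ^ 2 + k * dmax ^ 2 := by
    intro t ht
    rw [Finset.mem_range] at ht
    have e : ∀ j : ℕ, m₁ + (j : ℤ) - k + t = m₁ - k + t + j := fun j => by ring
    simp only [e]
    exact hcbk_window_le hd (m₁ - 1) (m₁ - k + t) n k (by omega) (by omega)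
  refine (Finset.sum_le_sum hb).trans ?_
  rw [Finset.sum_const, Finset.card_range, nsmul_eq_mul]

/-- The total loss of a block against the truncated far-pair bounds:
`∑_{j<n} ∑_{k} h_k k (w(m₁+j, k) + w(m₁+j-k, k)) ≤ κ W(m₁-1) + 2 cB dmax²`. [folklore] -/
theorem hcbk_loss_sum {κ cB dmax : ℝ} {d : ℤ → ℝ} {h : ℕ → ℝ}
    (hd : ∀ i, 0 ≤ d i ∧ d i ≤ dmax) (hh : ∀ k, 0 ≤ h k)
    (hκ' : ∀ K' : ℕ, ∑ k ∈ Finset.range K', 2 * ((k + 2 : ℕ) : ℝ) ^ 2 * h (k + 2) ≤ κ)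
    (hcB' : ∀ K' : ℕ, ∑ k ∈ Finset.range K', ((k + 2 : ℕ) : ℝ) ^ 3 * h (k + 2) ≤ cB)
    (m₁ : ℤ) (n K' : ℕ) :
    ∑ j ∈ Finset.range n, ∑ k ∈ Finset.range K',
        (h (k + 2) * ((k + 2 : ℕ) : ℝ) * ∑ t ∈ Finset.range (k + 2), d (m₁ + j + t) ^ 2 +
          h (k + 2) * ((k + 2 : ℕ) : ℝ) * ∑ t ∈ Finset.range (k + 2), d (m₁ + j - ((k + 2 : ℕ) : ℤ) + t) ^ 2) ≤
      κ * ∑ j ∈ Finset.range n, d (m₁ - 1 + j) ^ 2 + 2 * cB * dmax ^ 2 := by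
  rw [Finset.sum_comm]
  set W := ∑ j ∈ Finset.range n, d (m₁ - 1 + j) ^ 2 with hW
  have hW0 : 0 ≤ W := Finset.sum_nonneg (fun j _ => sq_nonneg _)
  have hdm : 0 ≤ dmax ^ 2 := sq_nonneg _
  have hk : ∀ k ∈ Finset.range K', ∑ j ∈ Finset.range n,
      (h (k + 2) * ((k + 2 : ℕ) : ℝ) * ∑ t ∈ Finset.range (k + 2), d (m₁ + j + t) ^ 2 +
        h (k + 2) * ((k + 2 : ℕ) : ℝ) * ∑ t ∈ Finset.range (k + 2), d (m₁ + j - ((k + 2 : ℕ) : ℤ) + t) ^ 2) ≤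
      2 * ((k + 2 : ℕ) : ℝ) ^ 2 * h (k + 2) * W + 2 * (((k + 2 : ℕ) : ℝ) ^ 3 * h (k + 2)) * dmax ^ 2 := by
    intro k _
    rw [Finset.sum_add_distrib, ← Finset.mul_sum, ← Finset.mul_sum]
    have h1 := hcbk_fwd_sum hd m₁ n (k + 2)
    have h2 := hcbk_bwd_sum hd m₁ n (k + 2)
    have hhk : 0 ≤ h (k + 2) * ((k + 2 : ℕ) : ℝ) := mul_nonneg (hh _) (Nat.cast_nonneg _)
    have h3 := mul_le_mul_of_nonneg_left h1 hhk
    have h4 := mul_le_mul_of_nonneg_left h2 hhk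
    have h5 : h (k + 2) * ((k + 2 : ℕ) : ℝ) * (((k + 2 : ℕ) : ℝ) * (W + ((k + 2 : ℕ) : ℝ) * dmax ^ 2)) +
        h (k + 2) * ((k + 2 : ℕ) : ℝ) * (((k + 2 : ℕ) : ℝ) * (W + ((k + 2 : ℕ) : ℝ) * dmax ^ 2)) =
        2 * ((k + 2 : ℕ) : ℝ) ^ 2 * h (k + 2) * W + 2 * (((k + 2 : ℕ) : ℝ) ^ 3 * h (k + 2)) * dmax ^ 2 := by
      ring
    linarith
  refine (Finset.sum_le_sum hk).trans ?_
  rw [Finset.sum_add_distrib, ← Finset.sum_mul, ← Finset.sum_mul, ← Finset.mul_sum]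
  have h6 := mul_le_mul_of_nonneg_right (hκ' K') hW0
  have h7 := mul_le_mul_of_nonneg_right (hcB' K') hdm
  linarith

/-- The two far pairs `(m, m + k)` and `(m, m - k)` of a layer, with their windows as `range` sums.
[folklore] -/
theorem hcbk_pair_far {d : ℤ → ℝ} {h : ℕ → ℝ} {D : ℤ → ℤ → ℝ}
    (hfar : ∀ (m : ℤ) (k : ℕ), 2 ≤ k →
      -(h k * k * ∑ i ∈ Finset.Ico m (m + k), d i ^ 2) ≤ D m (m + k) ∧
      -(h k * k * ∑ i ∈ Finset.Ico m (m + k), d i ^ 2) ≤ D (m + k) m)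
    (m : ℤ) (k : ℕ) (hk : 2 ≤ k) :
    -(h k * k * ∑ t ∈ Finset.range k, d (m + t) ^ 2 + h k * k * ∑ t ∈ Finset.range k, d (m - k + t) ^ 2) ≤
      D m (m + k) + D m (m + -(k : ℤ)) := by
  have h1 := (hfar m k hk).1
  have h2 := (hfar (m - k) k hk).2
  rw [hcbk_sum_Ico_eq_sum_range] at h1 h2
  rw [sub_add_cancel] at h2
  rw [← sub_eq_add_neg]
  linarith

/-- The per-layer bound: the symmetric partial sum `∑_{k < K'+2} (D m (m+k) + D m (m-k))` is at least the two
adjacent gains minus the truncated far-pair losses. [folklore] -/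
theorem hcbk_per_layer {κ : ℝ} {d b : ℤ → ℝ} {h : ℕ → ℝ} {D : ℤ → ℤ → ℝ}
    (hb : ∀ i, 0 ≤ b i) (hdiag : ∀ m, D m m = 0)
    (hadj : ∀ m : ℤ, κ * d m ^ 2 + b m ≤ D m (m + 1) ∧ κ * d m ^ 2 + b m ≤ D (m + 1) m)
    (hfar : ∀ (m : ℤ) (k : ℕ), 2 ≤ k →
      -(h k * k * ∑ i ∈ Finset.Ico m (m + k), d i ^ 2) ≤ D m (m + k) ∧
      -(h k * k * ∑ i ∈ Finset.Ico m (m + k), d i ^ 2) ≤ D (m + k) m)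
    (m : ℤ) (K' : ℕ) :
    κ * d m ^ 2 + b m + κ * d (m - 1) ^ 2 -
        ∑ k ∈ Finset.range K',
          (h (k + 2) * ((k + 2 : ℕ) : ℝ) * ∑ t ∈ Finset.range (k + 2), d (m + t) ^ 2 +
            h (k + 2) * ((k + 2 : ℕ) : ℝ) * ∑ t ∈ Finset.range (k + 2), d (m - ((k + 2 : ℕ) : ℤ) + t) ^ 2) ≤
      ∑ k ∈ Finset.range (K' + 2), (D m (m + k) + D m (m + -(k : ℤ))) := by
  rw [hcbk_range_add_two]
  have h0 : D m (m + ((0 : ℕ) : ℤ)) + D m (m + -((0 : ℕ) : ℤ)) = 0 := by simp [hdiag]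
  have h1 : κ * d m ^ 2 + b m + κ * d (m - 1) ^ 2 ≤ D m (m + ((1 : ℕ) : ℤ)) + D m (m + -((1 : ℕ) : ℤ)) := by
    have ha := (hadj m).1
    have hb' := (hadj (m - 1)).2
    have hbm := hb (m - 1)
    rw [sub_add_cancel] at hb'
    rw [Nat.cast_one, ← sub_eq_add_neg]
    linarith
  have h2 : ∀ k ∈ Finset.range K',
      -(h (k + 2) * ((k + 2 : ℕ) : ℝ) * ∑ t ∈ Finset.range (k + 2), d (m + t) ^ 2 +
          h (k + 2) * ((k + 2 : ℕ) : ℝ) * ∑ t ∈ Finset.range (k + 2), d (m - ((k + 2 : ℕ) : ℤ) + t) ^ 2) ≤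
        D m (m + ((k + 2 : ℕ) : ℤ)) + D m (m + -((k + 2 : ℕ) : ℤ)) :=
    fun k _ => hcbk_pair_far hfar m (k + 2) (by omega)
  have h3 := Finset.sum_le_sum h2
  rw [Finset.sum_neg_distrib] at h3
  linarith

/-- The symmetric partial sums of a summable family over `ℤ`, centred at `m` with vanishing diagonal term,
converge to its sum. [folklore] -/
theorem hcbk_tendsto {D : ℤ → ℤ → ℝ} {m : ℤ} (hs : Summable (D m)) (h0 : D m m = 0) :
    Tendsto (fun K : ℕ => ∑ k ∈ Finset.range K, (D m (m + k) + D m (m + -(k : ℤ)))) atTop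
      (𝓝 (∑' m', D m m')) := by
  have h1 : HasSum (fun j : ℤ => D m (m + j)) (∑' m', D m m') := by
    have h := (Equiv.addLeft m).hasSum_iff.mpr hs.hasSum
    have e : (D m ∘ ⇑(Equiv.addLeft m)) = fun j : ℤ => D m (m + j) := by
      ext j
      simp
    rwa [e] at h
  have h2 := h1.nat_add_neg
  simp only [add_zero, h0] at h2
  exact h2.tendsto_sum_nat

/-- The finite form of the block summation: for every truncation `K' + 2` of the symmetric partial sums.
[folklore] -/
theorem hcbk_finite {κ cB dmax : ℝ} {d b : ℤ → ℝ} {h : ℕ → ℝ} {D : ℤ → ℤ → ℝ}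
    (hκ : 0 ≤ κ) (hd : ∀ i, 0 ≤ d i ∧ d i ≤ dmax) (hb : ∀ i, 0 ≤ b i)
    (hh : ∀ k, 0 ≤ h k) (hdiag : ∀ m, D m m = 0)
    (hadj : ∀ m : ℤ, κ * d m ^ 2 + b m ≤ D m (m + 1) ∧ κ * d m ^ 2 + b m ≤ D (m + 1) m)
    (hfar : ∀ (m : ℤ) (k : ℕ), 2 ≤ k →
      -(h k * k * ∑ i ∈ Finset.Ico m (m + k), d i ^ 2) ≤ D m (m + k) ∧
      -(h k * k * ∑ i ∈ Finset.Ico m (m + k), d i ^ 2) ≤ D (m + k) m)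
    (hκ' : ∀ K' : ℕ, ∑ k ∈ Finset.range K', 2 * ((k + 2 : ℕ) : ℝ) ^ 2 * h (k + 2) ≤ κ)
    (hcB' : ∀ K' : ℕ, ∑ k ∈ Finset.range K', ((k + 2 : ℕ) : ℝ) ^ 3 * h (k + 2) ≤ cB)
    (m₁ : ℤ) (n K' : ℕ) :
    (∑ m ∈ Finset.Ico m₁ (m₁ + n), (κ * d m ^ 2 + b m)) - (2 * cB + 2 * κ) * dmax ^ 2 ≤
      ∑ m ∈ Finset.Ico m₁ (m₁ + n), ∑ k ∈ Finset.range (K' + 2), (D m (m + k) + D m (m + -(k : ℤ))) := by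
  rw [hcbk_sum_Ico_eq_sum_range, hcbk_sum_Ico_eq_sum_range]
  have hsum1 := Finset.sum_le_sum
    (fun j (_ : j ∈ Finset.range n) => hcbk_per_layer hb hdiag hadj hfar (m₁ + j) K')
  rw [Finset.sum_sub_distrib, Finset.sum_add_distrib] at hsum1
  have hloss := hcbk_loss_sum hd hh hκ' hcB' m₁ n K'
  have hW : ∑ j ∈ Finset.range n, κ * d (m₁ + (j : ℤ) - 1) ^ 2 =
      κ * ∑ j ∈ Finset.range n, d (m₁ - 1 + j) ^ 2 := by
    rw [Finset.mul_sum]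
    exact Finset.sum_congr rfl (fun j _ => by rw [show m₁ + (j : ℤ) - 1 = m₁ - 1 + j by ring])
  have hdm : 0 ≤ dmax ^ 2 := sq_nonneg _
  have hκd : 0 ≤ κ * dmax ^ 2 := mul_nonneg hκ hdm
  linarith

/-- **Abstract block summation** (stub `hc_blockSum` of the hollow closing). `D m m'` are pair differences
(summable in `m'`, zero on the diagonal), `d i ∈ [0, dmax]` offset defects, `b i ≥ 0` gap gains, `h k ≥ 0`
far-layer constants; adjacent pairs gain `κ d_m² + b_m` in both orientations, far pairs `(m, m ± k)` lose at most
`h_k k ∑_{window} d_i²`, and `∑ 2k² h_k ≤ κ`, `∑ k³ h_k ≤ cB`. Then over any block of layers `[m₁, m₁ + n)`,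
`∑_m ∑'_{m'} D m m' ≥ ∑_m (κ d_m² + b_m) − (2 cB + 2 κ) dmax²`. [folklore] -/
theorem hc_blockSum : ∀ (κ cB dmax : ℝ) (d b : ℤ → ℝ) (h : ℕ → ℝ) (D : ℤ → ℤ → ℝ), 0 ≤ κ → 0 ≤ cB →
    (∀ i, 0 ≤ d i ∧ d i ≤ dmax) → (∀ i, 0 ≤ b i) → (∀ k, 0 ≤ h k) → (∀ m, Summable (D m)) → (∀ m, D m m = 0) →
    (∀ m : ℤ, κ * d m ^ 2 + b m ≤ D m (m + 1) ∧ κ * d m ^ 2 + b m ≤ D (m + 1) m) →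
    (∀ (m : ℤ) (k : ℕ), 2 ≤ k →
      -(h k * k * ∑ i ∈ Finset.Ico m (m + k), d i ^ 2) ≤ D m (m + k) ∧
      -(h k * k * ∑ i ∈ Finset.Ico m (m + k), d i ^ 2) ≤ D (m + k) m) →
    (∀ K : ℕ, ∑ k ∈ Finset.Icc 2 K, 2 * (k : ℝ) ^ 2 * h k ≤ κ) →
    (∀ K : ℕ, ∑ k ∈ Finset.Icc 2 K, (k : ℝ) ^ 3 * h k ≤ cB) →
    ∀ (m₁ : ℤ) (n : ℕ),
      (∑ m ∈ Finset.Ico m₁ (m₁ + n), (κ * d m ^ 2 + b m)) - (2 * cB + 2 * κ) * dmax ^ 2 ≤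
        ∑ m ∈ Finset.Ico m₁ (m₁ + n), ∑' m' : ℤ, D m m' := by
  intro κ cB dmax d b h D hκ _hcB hd hb hh hsum hdiag hadj hfar hκsum hcBsum m₁ n
  have hκ' : ∀ K' : ℕ, ∑ k ∈ Finset.range K', 2 * ((k + 2 : ℕ) : ℝ) ^ 2 * h (k + 2) ≤ κ := by
    intro K'
    have h1 := hκsum (K' + 1)
    rwa [hcbk_Icc_range] at h1
  have hcB' : ∀ K' : ℕ, ∑ k ∈ Finset.range K', ((k + 2 : ℕ) : ℝ) ^ 3 * h (k + 2) ≤ cB := by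
    intro K'
    have h1 := hcBsum (K' + 1)
    rwa [hcbk_Icc_range] at h1
  have hlim : Tendsto (fun K : ℕ => ∑ m ∈ Finset.Ico m₁ (m₁ + n),
      ∑ k ∈ Finset.range K, (D m (m + k) + D m (m + -(k : ℤ)))) atTop
      (𝓝 (∑ m ∈ Finset.Ico m₁ (m₁ + n), ∑' m', D m m')) :=
    tendsto_finsetSum _ (fun m _ => hcbk_tendsto (hsum m) (hdiag m))
  refine ge_of_tendsto hlim (Filter.eventually_atTop.2 ⟨2, fun K hK => ?_⟩)
  obtain ⟨K', rfl⟩ := Nat.exists_eq_add_of_le' hK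
  exact hcbk_finite hκ hd hb hh hdiag hadj hfar hκ' hcB' m₁ n K'

end Summit.AtomisticToContinuum.Crystallization.Theorems.PeriodicWindowsDenseLaminarHull

end
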